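import Summits.AtomisticToContinuum.BoseEinsteinCondensation.Theorems.BECCellInformationCellInformationBoundOfCondEntropy

/-!
# Route `BECCellInformation` — the trivial ceiling of the crux functional, typed:
# `I(cell(x₁); Y) ≤ log M³` for every trial state (crux `CellInformationBound`, stmt-AtomisticToContinuum-13439)

Support file (`--supports stmt-AtomisticToContinuum-13439`). The coarse mutual-information integrand of
`Summit.AtomisticToContinuum.BoseEinsteinCondensation.Theses.BECCellInformation.CellInformationBound`
at cell side `L/M` has `∫⁻ dY ≤ ofReal(log M³)` for EVERY trial state `Ψ ∈ TrialState (n+1) L`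
(`L > 0`, `M ≥ 1`): `I(cell(x₁); Y) ≤ E_Y KL(Q(·|Y) ‖ ū) ≤ log M³`. This certifies in the kernel the
scale of the typed functional recorded in the item's informal text ("trivially `I ≤ log M³ = log(N/(ρl³))`;
the claim is `O(1)`"): finite at fixed `N`, with the only `N`-dependence through `M = ⌈L/l⌉₊`.

Proof: `lintegral_ofReal_sum_mi_le_coarse` (mutual information ≤ coarse conditional entropy, Gibbs) and
the pointwise bound `Σ_k (m/K) klFun(K A_k/m) = Σ_k A_k log(K A_k/m) ≤ m log K` (`A_k ≤ m`), then
`∫ m(Y) dY = 1`. [Cover–Thomas, Thm 2.6.4: `H(X) ≤ log |𝒳|`.]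
-/

noncomputable section

namespace Summit.AtomisticToContinuum.BoseEinsteinCondensation.Theorems

open MeasureTheory Set InformationTheory
open scoped ENNReal
open Literature.MathematicalPhysics.QuantumManyBody.BoseGas

namespace CellInformationBound.Ceiling

open CoarseChainRule CellInformationBound.OfCondEntropy

/-! ### The trivial ceiling `I(cell(x₁); Y) ≤ log M³`, typed -/

/-- **Coarse conditional entropy is at most `m log K` pointwise**: for nonnegative weights `A_k` with
`Σ_k A_k = m` on an alphabet of size `K`, `Σ_k (m/K) klFun(K A_k/m) ≤ m log K`
(`= m · KL(A/m ‖ uniform) ≤ m · log K`, since `A_k ≤ m`). [cite: CoverThomas2005, Thm 2.6.4] -/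
theorem sum_coarse_le_mul_log {ι : Type*} [Fintype ι] {K m : ℝ} (hK : (Fintype.card ι : ℝ) = K)
    (hKpos : 0 < K) {A : ι → ℝ} (hA : ∀ k, 0 ≤ A k) (hsumA : ∑ k, A k = m) :
    ∑ k, m / K * klFun (K * A k / m) ≤ m * Real.log K := by
  have hm : 0 ≤ m := hsumA ▸ Finset.sum_nonneg fun k _ => hA k
  rcases hm.eq_or_lt with hm0 | hmpos
  · rw [← hm0]
    simp
  have hKne : K ≠ 0 := hKpos.ne'
  have hmne : m ≠ 0 := hmpos.ne'
  have hAle : ∀ k, A k ≤ m := fun k =>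
    hsumA ▸ Finset.single_le_sum (fun j _ => hA j) (Finset.mem_univ k)
  have hpt : ∀ k, m / K * klFun (K * A k / m) = A k * Real.log (K * A k / m) + (m / K - A k) := by
    intro k
    rw [klFun_apply]
    field_simp
    ring
  have hsum : ∑ k, m / K * klFun (K * A k / m) = ∑ k, A k * Real.log (K * A k / m) := by
    simp only [hpt, Finset.sum_add_distrib, Finset.sum_sub_distrib, Finset.sum_const,
      Finset.card_univ, nsmul_eq_mul, hK, hsumA, mul_div_cancel₀ m hKne, sub_self, add_zero]
  rw [hsum, ← hsumA, Finset.sum_mul, hsumA]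
  refine Finset.sum_le_sum fun k _ => ?_
  rcases (hA k).eq_or_lt with hA0 | hApos
  · rw [← hA0]
    simp
  · refine mul_le_mul_of_nonneg_left (Real.log_le_log (by positivity) ?_) (hA k)
    calc K * A k / m ≤ K * m / m := by gcongr; exact hAle k
      _ = K := by field_simp

/-- **Trivial ceiling for the crux functional (fixed `N = n+1`, `L > 0`, `M ≥ 1`, any trial state):**
`I(cell(x₁); Y) ≤ log M³` — the typed coarse mutual-information integrand of `CellInformationBound`
at cell side `L/M` has `∫⁻ dY ≤ ofReal(log M³)` (finite at fixed `N`; the crux asserts `O(1)` as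
`M ~ L/l → ∞`). [cite: CoverThomas2005, Thm 2.6.4] -/
theorem lintegral_cellInformation_le_log {n : ℕ} {L : ℝ} (hL : 0 < L) {M : ℕ} (hM : 0 < M)
    (Ψ : TrialState (n + 1) L) :
    ∫⁻ Y : Config n, ENNReal.ofReal (∑ k : Fin 3 → Fin M,
      (∫ z, ‖Ψ.ψ (Matrix.vecCons z Y)‖ ^ 2) *
        (∫ Y' : Config n, ∫ x in {y : Space | ∀ j, y j ∈
          Set.Ico (((k j : ℕ) : ℝ) * (L / (M : ℝ))) ((((k j : ℕ) : ℝ) + 1) * (L / (M : ℝ)))},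
          ‖Ψ.ψ (Matrix.vecCons x Y')‖ ^ 2) *
        klFun ((∫ x in {y : Space | ∀ j, y j ∈
          Set.Ico (((k j : ℕ) : ℝ) * (L / (M : ℝ))) ((((k j : ℕ) : ℝ) + 1) * (L / (M : ℝ)))},
          ‖Ψ.ψ (Matrix.vecCons x Y)‖ ^ 2) /
          ((∫ z, ‖Ψ.ψ (Matrix.vecCons z Y)‖ ^ 2) *
            (∫ Y' : Config n, ∫ x in {y : Space | ∀ j, y j ∈
              Set.Ico (((k j : ℕ) : ℝ) * (L / (M : ℝ))) ((((k j : ℕ) : ℝ) + 1) * (L / (M : ℝ)))},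
              ‖Ψ.ψ (Matrix.vecCons x Y')‖ ^ 2)))) ≤
      ENNReal.ofReal (Real.log ((M : ℝ) ^ 3)) := by
  have hMr : (0 : ℝ) < M := Nat.cast_pos.2 hM
  have hKpos : 0 < (M : ℝ) ^ 3 := by positivity
  have hK1 : (1 : ℝ) ≤ (M : ℝ) ^ 3 := one_le_pow₀ (by exact_mod_cast hM)
  have hlog0 : 0 ≤ Real.log ((M : ℝ) ^ 3) := Real.log_nonneg hK1
  have hcard : (Fintype.card (Fin 3 → Fin M) : ℝ) = (M : ℝ) ^ 3 := by
    rw [Fintype.card_fun, Fintype.card_fin, Fintype.card_fin, Nat.cast_pow]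
  let cell : (Fin 3 → Fin M) → Set Space := fun k => {y : Space | ∀ j, y j ∈
    Set.Ico (((k j : ℕ) : ℝ) * (L / (M : ℝ))) ((((k j : ℕ) : ℝ) + 1) * (L / (M : ℝ)))}
  have hA0 : ∀ k (Y : Config n), 0 ≤ ∫ x in cell k, ‖Ψ.ψ (Matrix.vecCons x Y)‖ ^ 2 :=
    fun k Y => integral_nonneg fun x => sq_nonneg _
  have hAi : ∀ k, Integrable (fun Y : Config n => ∫ x in cell k, ‖Ψ.ψ (Matrix.vecCons x Y)‖ ^ 2) :=
    fun k => integrable_setIntegral_normSq_vecCons Ψ (cell k)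
  have hsumA : ∀ᵐ Y : Config n, ∑ k, ∫ x in cell k, ‖Ψ.ψ (Matrix.vecCons x Y)‖ ^ 2 =
      ∫ z, ‖Ψ.ψ (Matrix.vecCons z Y)‖ ^ 2 := ae_sum_setIntegral_cell_eq hL hM Ψ
  have hsumP : ∑ k, ∫ Y : Config n, ∫ x in cell k, ‖Ψ.ψ (Matrix.vecCons x Y)‖ ^ 2 = 1 := by
    rw [← integral_finsetSum _ fun k _ => hAi k, integral_congr_ae hsumA]
    exact integral_integral_normSq_vecCons Ψ
  have h1 := lintegral_ofReal_sum_mi_le_coarse (μ := volume) hcard hKpos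
    (m := fun Y : Config n => ∫ z, ‖Ψ.ψ (Matrix.vecCons z Y)‖ ^ 2)
    (A := fun k (Y : Config n) => ∫ x in cell k, ‖Ψ.ψ (Matrix.vecCons x Y)‖ ^ 2)
    (P := fun k => ∫ Y : Config n, ∫ x in cell k, ‖Ψ.ψ (Matrix.vecCons x Y)‖ ^ 2)
    hA0 hAi (fun k => rfl) hsumA hsumP
  refine h1.trans ?_
  -- pointwise ceiling `coarse ≤ m log M³`, then `∫ m = 1`
  have hpt : ∀ᵐ Y : Config n, ENNReal.ofReal (∑ k, (∫ z, ‖Ψ.ψ (Matrix.vecCons z Y)‖ ^ 2) / (M : ℝ) ^ 3 *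
        klFun ((M : ℝ) ^ 3 * (∫ x in cell k, ‖Ψ.ψ (Matrix.vecCons x Y)‖ ^ 2) /
          ∫ z, ‖Ψ.ψ (Matrix.vecCons z Y)‖ ^ 2)) ≤
      ENNReal.ofReal (Real.log ((M : ℝ) ^ 3)) * ENNReal.ofReal (∫ z, ‖Ψ.ψ (Matrix.vecCons z Y)‖ ^ 2) := by
    filter_upwards [hsumA] with Y hsum
    rw [← ENNReal.ofReal_mul hlog0, mul_comm]
    exact ENNReal.ofReal_le_ofReal (sum_coarse_le_mul_log hcard hKpos (fun k => hA0 k Y) hsum)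
  have hmi : Integrable (fun Y : Config n => ∫ z, ‖Ψ.ψ (Matrix.vecCons z Y)‖ ^ 2) := by
    have h := integrable_setIntegral_normSq_vecCons Ψ Set.univ
    simp only [Measure.restrict_univ] at h
    exact h
  have hm1 : ∫⁻ Y : Config n, ENNReal.ofReal (∫ z, ‖Ψ.ψ (Matrix.vecCons z Y)‖ ^ 2) = 1 := by
    rw [← ofReal_integral_eq_lintegral_ofReal hmi
      (ae_of_all _ fun Y => integral_nonneg fun z => sq_nonneg _),
      integral_integral_normSq_vecCons Ψ, ENNReal.ofReal_one]
  calc ∫⁻ Y : Config n, ENNReal.ofReal (∑ k, (∫ z, ‖Ψ.ψ (Matrix.vecCons z Y)‖ ^ 2) / (M : ℝ) ^ 3 *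
          klFun ((M : ℝ) ^ 3 * (∫ x in cell k, ‖Ψ.ψ (Matrix.vecCons x Y)‖ ^ 2) /
            ∫ z, ‖Ψ.ψ (Matrix.vecCons z Y)‖ ^ 2))
      ≤ ∫⁻ Y : Config n, ENNReal.ofReal (Real.log ((M : ℝ) ^ 3)) *
          ENNReal.ofReal (∫ z, ‖Ψ.ψ (Matrix.vecCons z Y)‖ ^ 2) := lintegral_mono_ae hpt
    _ = ENNReal.ofReal (Real.log ((M : ℝ) ^ 3)) *
          ∫⁻ Y : Config n, ENNReal.ofReal (∫ z, ‖Ψ.ψ (Matrix.vecCons z Y)‖ ^ 2) :=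
        lintegral_const_mul' _ _ ENNReal.ofReal_ne_top
    _ = ENNReal.ofReal (Real.log ((M : ℝ) ^ 3)) := by rw [hm1, mul_one]

/-- **Registered form (`cellInformation_le_log`): the trivial ceiling of the crux functional.** For every
`n`, `L > 0`, `M ≥ 1` and every trial state `Ψ ∈ TrialState (n+1) L`, the coarse mutual-information
functional of `CellInformationBound` at cell side `L/M` is at most `ofReal(log M³)`.
[cite: CoverThomas2005, Thm 2.6.4] -/
theorem cellInformation_le_log :
    ∀ (n : ℕ) (L : ℝ), 0 < L → ∀ (M : ℕ), 0 < M → ∀ Ψ : Literature.MathematicalPhysics.QuantumManyBody.BoseGas.TrialState (n + 1) L, ∫⁻ Y : Literature.MathematicalPhysics.QuantumManyBody.BoseGas.Config n, ENNReal.ofReal (∑ k : Fin 3 → Fin M, (∫ z, ‖Ψ.ψ (Matrix.vecCons z Y)‖ ^ 2) * (∫ Y' : Literature.MathematicalPhysics.QuantumManyBody.BoseGas.Config n, ∫ x in {y : EuclideanSpace ℝ (Fin 3) | ∀ j, y j ∈ Set.Ico (((k j : ℕ) : ℝ) * (L / (M : ℝ))) ((((k j : ℕ) : ℝ) + 1)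 * (L / (M : ℝ)))}, ‖Ψ.ψ (Matrix.vecCons x Y')‖ ^ 2) * InformationTheory.klFun ((∫ x in {y : EuclideanSpace ℝ (Fin 3) | ∀ j, y j ∈ Set.Ico (((k j : ℕ) : ℝ) * (L / (M : ℝ))) ((((k j : ℕ) : ℝ) + 1) * (L / (M : ℝ)))}, ‖Ψ.ψ (Matrix.vecCons x Y)‖ ^ 2) / ((∫ z, ‖Ψ.ψ (Matrix.vecCons z Y)‖ ^ 2) * (∫ Y' : Literature.MathematicalPhysics.QuantumManyBody.BoseGas.Config n, ∫ x in {y : EuclideanSpace ℝ (Fin 3) | ∀ j, y j ∈ Set.Ico (((k j : ℕ) : ℝ) * (L / (M : ℝ))) ((((k j : ℕ) : ℝ) + 1) * (L / (M : ℝ)))}, ‖Ψ.ψ (Matrix.vecCons x Y')‖ ^ 2)))) ≤ ENNReal.ofReal (Real.log ((M : ℝ) ^ 3)) := by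
  intro n L hL M hM Ψ
  exact lintegral_cellInformation_le_log hL hM Ψ

end CellInformationBound.Ceiling

end Summit.AtomisticToContinuum.BoseEinsteinCondensation.Theorems

end
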